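import Summits.CriticalPhenomena.CardyFormulaZ2.Theorems.CardyBoundaryCoulombGasBoundaryDefectGaussianRStubTransferPart4
import Literature.Probability.RandomPlanarGeometry.PlanarDomains

/-!
# Stub `stub_transfer` of line `rainbow-monomials-in-excursion-kernels` — Part 5: orientation at a
# flat mark and the flat-mark geometry GEOM (crux `CardyBoundaryCoulombGas.BoundaryDefectGaussianR`,
# stmt-CriticalPhenomena-14132)

* `transfer_orientation` — the "interior on the left" clause: if `Re (w ∘ ∂D)` is strictly
  increasing near the mark `i` (flat, non-corner) of a marked Jordan domain `D` and `w : D → ℍ` is a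
  holomorphic bijection with `w′(pt i) ≠ 0`, then for the unit direction `τ` in which the boundary
  curve leaves `pt i`, the points `pt i + sτI`, `0 < s` small, lie in `D`. Proof: the boundary
  curve near the mark is a continuous injective, hence strictly monotone, parametrisation of the
  flat piece; `w` is real there with `Re` increasing, so `w′(pt i)τ > 0`; by
  `transfer_halfBall_subset` one side is inside, and the side `−τI` is excluded to first order
  (`transfer_im_deriv_mul_nonneg`).
* `s6_flatMarkGeometry` (registered sub-goal) — GEOM, the first hypothesis of
  `s6_transferOfGeometry` (Part 2): orientation at
  every mark, `w′(pt i) ≠ 0` (`transfer_deriv_ne_zero`), and injectivity of `w` on the marks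
  (`transfer_boundary_injective`).

All [folklore].
-/

noncomputable section

open Filter Topology Set
open Literature.Probability.RandomPlanarGeometry

namespace Summit.CriticalPhenomena.CardyFormulaZ2.Cruxes.BoundaryDefectGaussianR.RainbowMonomialsInExcursionKernels

/-- The boundary loop of a Jordan domain is injective on every open parameter interval of length
`1` (injective on a period, `1`-periodic). [folklore] -/
theorem transfer_boundary_injOn (D : JordanDomain) (m : ℝ) :
    Set.InjOn D.boundary (Set.Ioo (m - 1 / 2) (m + 1 / 2)) := by
  intro t ht t' ht' h
  have hper : ∀ x : ℝ, D.boundary (Int.fract x) = D.boundary x := fun x ↦ by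
    rw [← Int.self_sub_floor, ← mul_one (⌊x⌋ : ℝ)]
    exact D.periodic_boundary.sub_int_mul_eq ⌊x⌋
  have h1 : D.boundary (Int.fract t) = D.boundary (Int.fract t') := by rw [hper, hper, h]
  have h2 := D.injOn_boundary ⟨Int.fract_nonneg t, Int.fract_lt_one t⟩
    ⟨Int.fract_nonneg t', Int.fract_lt_one t'⟩ h1
  obtain ⟨z, hz⟩ := Int.fract_eq_fract.mp h2
  have hz1 : |(z : ℝ)| < 1 := by
    rw [← hz, abs_lt]
    constructor <;> linarith [ht.1, ht.2, ht'.1, ht'.2]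
  have hz0 : z = 0 := by
    have h3 : |z| < 1 := by exact_mod_cast hz1
    exact Int.abs_lt_one_iff.mp h3
  rw [hz0, Int.cast_zero, sub_eq_zero] at hz
  exact hz

/-- The two flatness alternatives of the crux (horizontal / vertical boundary piece) in the
uniform form "`∂Ω ∩ B(b,r)` lies on the line `b + ℝτ₀`", `τ₀ ∈ {1, I}`. [folklore] -/
theorem transfer_flat_dir {Ω : Set ℂ} {b : ℂ} {r : ℝ}
    (hflat : (∀ z ∈ frontier Ω, dist z b < r → z.im = b.im) ∨
      (∀ z ∈ frontier Ω, dist z b < r → z.re = b.re)) :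
    ∃ τ₀ : ℂ, ‖τ₀‖ = 1 ∧ ∀ z ∈ frontier Ω, dist z b < r → ((z - b) / τ₀).im = 0 := by
  rcases hflat with h | h
  · refine ⟨1, by simp, fun z hz hzr ↦ ?_⟩
    rw [div_one, Complex.sub_im, h z hz hzr, sub_self]
  · refine ⟨Complex.I, by simp, fun z hz hzr ↦ ?_⟩
    rw [Complex.div_I, Complex.neg_im, Complex.mul_I_im, Complex.sub_re, h z hz hzr, sub_self,
      neg_zero]

/-- **Monotone line coordinate.** A continuous curve, injective on `[m − ε₁, m + ε₁]` and valued
there on the line `γ(m) + ℝτ₀`, is `γ(t) = γ(m) + μ(t)τ` with `τ = ±τ₀` and `μ` continuous,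
strictly increasing, `μ(m) = 0`. [folklore] -/
theorem transfer_line_param {γ : ℝ → ℂ} (hγ : Continuous γ) {m ε₁ : ℝ} (hε₁ : 0 < ε₁)
    (hinj : Set.InjOn γ (Set.Icc (m - ε₁) (m + ε₁))) {τ₀ : ℂ} (hτ₀ : ‖τ₀‖ = 1)
    (hline : ∀ t ∈ Set.Icc (m - ε₁) (m + ε₁), ((γ t - γ m) / τ₀).im = 0) :
    ∃ τ : ℂ, ∃ μ : ℝ → ℝ, ‖τ‖ = 1 ∧ (τ = τ₀ ∨ τ = -τ₀) ∧
      StrictMonoOn μ (Set.Icc (m - ε₁) (m + ε₁)) ∧ Continuous μ ∧ μ m = 0 ∧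
      ∀ t ∈ Set.Icc (m - ε₁) (m + ε₁), γ t = γ m + (μ t : ℂ) * τ := by
  have hτ0 : τ₀ ≠ 0 := fun h ↦ by simp [h] at hτ₀
  set lam : ℝ → ℝ := fun t ↦ ((γ t - γ m) / τ₀).re with hlam
  have hlc : Continuous lam := by
    rw [hlam]
    fun_prop
  have hrepr : ∀ t ∈ Set.Icc (m - ε₁) (m + ε₁), γ t = γ m + (lam t : ℂ) * τ₀ := by
    intro t ht
    have h1 : (γ t - γ m) / τ₀ = (lam t : ℂ) :=
      Complex.ext (by simp [hlam]) (by rw [hline t ht, Complex.ofReal_im])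
    rw [div_eq_iff hτ0] at h1
    rw [← h1]
    ring
  have hlam0 : lam m = 0 := by simp [hlam]
  have hli : Set.InjOn lam (Set.Icc (m - ε₁) (m + ε₁)) := fun t ht t' ht' h ↦
    hinj ht ht' (by rw [hrepr t ht, hrepr t' ht', h])
  rcases hlc.continuousOn.strictMonoOn_of_injOn_Icc' (by linarith) hli with hmono | hanti
  · exact ⟨τ₀, lam, hτ₀, Or.inl rfl, hmono, hlc, hlam0, hrepr⟩
  · refine ⟨-τ₀, fun t ↦ -lam t, by rw [norm_neg, hτ₀], Or.inr rfl,
      fun x hx y hy hxy ↦ neg_lt_neg (hanti hx hy hxy), hlc.neg, by simp only [hlam0, neg_zero],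
      fun t ht ↦ ?_⟩
    rw [hrepr t ht]
    push_cast
    ring

/-- A continuous strictly increasing `μ` on `[m − ε₁, m + ε₁]` with `μ(m) = 0` attains every
small value. [folklore] -/
theorem transfer_param_window {μ : ℝ → ℝ} {m ε₁ : ℝ} (hε₁ : 0 < ε₁)
    (hμ : StrictMonoOn μ (Set.Icc (m - ε₁) (m + ε₁))) (hμc : Continuous μ) (hμ0 : μ m = 0) :
    ∃ η : ℝ, 0 < η ∧ ∀ u : ℝ, |u| < η → ∃ t ∈ Set.Icc (m - ε₁) (m + ε₁), μ t = u := by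
  have hm : m ∈ Set.Icc (m - ε₁) (m + ε₁) := ⟨by linarith, by linarith⟩
  have ha : m - ε₁ ∈ Set.Icc (m - ε₁) (m + ε₁) := ⟨le_rfl, by linarith⟩
  have hb : m + ε₁ ∈ Set.Icc (m - ε₁) (m + ε₁) := ⟨by linarith, le_rfl⟩
  have h1 : μ (m - ε₁) < 0 := by
    rw [← hμ0]
    exact hμ ha hm (by linarith)
  have h2 : 0 < μ (m + ε₁) := by
    rw [← hμ0]
    exact hμ hm hb (by linarith)
  refine ⟨min (-μ (m - ε₁)) (μ (m + ε₁)), lt_min (by linarith) h2, fun u hu ↦ ?_⟩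
  have hu' := abs_lt.mp hu
  have hIVT := intermediate_value_Icc (by linarith : m - ε₁ ≤ m + ε₁) hμc.continuousOn
  obtain ⟨t, ht, htu⟩ := hIVT ⟨by linarith [min_le_left (-μ (m - ε₁)) (μ (m + ε₁))],
    by linarith [min_le_right (-μ (m - ε₁)) (μ (m + ε₁))]⟩
  exact ⟨t, ht, htu⟩

/-- **Orientation at a flat mark ("interior on the left").** See the module docstring. [folklore] -/
theorem transfer_orientation {k : ℕ} (D : MarkedDomain k) (i : Fin k) {w : ℂ → ℂ} {U : Set ℂ}
    (hU : IsOpen U) (hsub : D.carrier ⊆ U) (hpt : D.pt i ∈ U) (hw : DifferentiableOn ℂ w U)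
    (hbij : Set.BijOn w D.carrier {z : ℂ | 0 < z.im})
    (hflat : ∃ r : ℝ, 0 < r ∧ ((∀ z ∈ frontier D.carrier, dist z (D.pt i) < r →
      z.im = (D.pt i).im) ∨ (∀ z ∈ frontier D.carrier, dist z (D.pt i) < r → z.re = (D.pt i).re)))
    (hmono : ∃ ε : ℝ, 0 < ε ∧ StrictMonoOn (fun t : ℝ ↦ (w (D.boundary t)).re)
      (Set.Ioo (D.mark i - ε) (D.mark i + ε)))
    (hderiv : deriv w (D.pt i) ≠ 0) :
    ∃ τ : ℂ, ‖τ‖ = 1 ∧ (∃ ε : ℝ, 0 < ε ∧ ∀ t ∈ Set.Ioo (D.mark i) (D.mark i + ε), ∃ s : ℝ,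
      0 < s ∧ D.boundary t = D.pt i + (s : ℂ) * τ) ∧ (∃ ε : ℝ, 0 < ε ∧ ∀ s ∈ Set.Ioo (0 : ℝ) ε,
      D.pt i + (s : ℂ) * (τ * Complex.I) ∈ D.carrier) := by
  obtain ⟨r₀, hr₀, hfl₀⟩ := hflat
  obtain ⟨ε, hε, hmn⟩ := hmono
  have hΩ : IsOpen D.carrier := D.isOpen
  have hpos : ∀ z ∈ D.carrier, 0 < (w z).im := fun z hz ↦ hbij.mapsTo hz
  have hbf : D.pt i ∈ frontier D.carrier := D.pt_mem_frontier i
  have hptdef : D.boundary (D.mark i) = D.pt i := rfl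
  -- a radius inside `U`
  obtain ⟨r₁, hr₁, hr₁U⟩ := Metric.isOpen_iff.mp hU (D.pt i) hpt
  have hr0 : 0 < min r₀ r₁ := lt_min hr₀ hr₁
  have hrU : ∀ z, dist z (D.pt i) < min r₀ r₁ → z ∈ U := fun z hz ↦
    hr₁U (lt_of_lt_of_le hz (min_le_right _ _))
  -- the flat direction
  obtain ⟨τ₀, hτ₀, hfl⟩ : ∃ τ₀ : ℂ, ‖τ₀‖ = 1 ∧ ∀ z ∈ frontier D.carrier,
      dist z (D.pt i) < min r₀ r₁ → ((z - D.pt i) / τ₀).im = 0 := by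
    obtain ⟨τ₀, hτ₀, h⟩ := transfer_flat_dir hfl₀
    exact ⟨τ₀, hτ₀, fun z hz hzr ↦ h z hz (lt_of_lt_of_le hzr (min_le_left _ _))⟩
  -- `w` is real on the frontier near `pt i`
  have hreal : ∀ z ∈ frontier D.carrier, dist z (D.pt i) < min r₀ r₁ → (w z).im = 0 :=
    fun z hz hzr ↦ transfer_im_eq_zero_of_frontier hΩ hU hsub hw hbij hz (hrU z hzr)
  -- a parameter window on which the boundary curve stays in the flat ball
  have hγc := D.continuous_boundary
  obtain ⟨δ₀, hδ₀, hδ⟩ : ∃ δ₀ > 0, ∀ t : ℝ, dist t (D.mark i) < δ₀ →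
      dist (D.boundary t) (D.pt i) < min r₀ r₁ :=
    Metric.continuous_iff.mp hγc (D.mark i) (min r₀ r₁) hr0
  set ε₁ := min ε (min (1 / 4) δ₀) / 2 with hε₁
  have hm0 : 0 < min ε (min (1 / 4) δ₀) := lt_min hε (lt_min (by norm_num) hδ₀)
  have hε₁0 : 0 < ε₁ := by positivity
  have hε₁ε : ε₁ < ε := by
    have h := min_le_left ε (min (1 / 4) δ₀)
    linarith
  have hε₁h : ε₁ < 1 / 2 := by
    have h := (min_le_right ε (min (1 / 4) δ₀)).trans (min_le_left _ _)
    linarith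
  have hε₁δ : ε₁ < δ₀ := by
    have h := (min_le_right ε (min (1 / 4) δ₀)).trans (min_le_right _ _)
    linarith
  have hJ : ∀ t ∈ Set.Icc (D.mark i - ε₁) (D.mark i + ε₁),
      dist (D.boundary t) (D.pt i) < min r₀ r₁ ∧ t ∈ Set.Ioo (D.mark i - ε) (D.mark i + ε) := by
    intro t ht
    refine ⟨hδ t ?_, by linarith [ht.1], by linarith [ht.2]⟩
    rw [Real.dist_eq, abs_lt]
    constructor <;> linarith [ht.1, ht.2]
  have hinjJ : Set.InjOn D.boundary (Set.Icc (D.mark i - ε₁) (D.mark i + ε₁)) :=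
    (transfer_boundary_injOn D.toJordanDomain (D.mark i)).mono
      (Set.Icc_subset_Ioo (by linarith) (by linarith))
  have hline : ∀ t ∈ Set.Icc (D.mark i - ε₁) (D.mark i + ε₁),
      ((D.boundary t - D.boundary (D.mark i)) / τ₀).im = 0 :=
    fun t ht ↦ hfl _ (D.boundary_mem_frontier t) (hJ t ht).1
  obtain ⟨τ, μ, hτ, hττ₀, hμ, hμc, hμ0, hrepr⟩ := transfer_line_param hγc hε₁0 hinjJ hτ₀ hline
  rw [hptdef] at hrepr
  obtain ⟨η, hη, hwin⟩ := transfer_param_window hε₁0 hμ hμc hμ0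
  have hτne : τ ≠ 0 := fun h ↦ by simp [h] at hτ
  -- derivative data at `pt i`
  have han : AnalyticAt ℂ w (D.pt i) := hw.analyticAt (hU.mem_nhds hpt)
  have hwd : HasDerivAt w (deriv w (D.pt i)) (D.pt i) := han.differentiableAt.hasDerivAt
  have hwb : (w (D.pt i)).im = 0 := hreal _ hbf (by rw [dist_self]; exact hr0)
  have hdi : (deriv w (D.pt i) * τ).im = 0 := by
    refine transfer_im_deriv_mul_eq_zero hη (fun u hu ↦ ?_) hwd
    obtain ⟨t, ht, htu⟩ := hwin u hu
    rw [← htu, ← hrepr t ht]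
    exact hreal _ (D.boundary_mem_frontier t) (hJ t ht).1
  have hdr : 0 ≤ (deriv w (D.pt i) * τ).re := by
    refine transfer_re_deriv_mul_nonneg hη (fun u₁ hu₁ u₂ hu₂ h12 ↦ ?_) hwd
    obtain ⟨t₁, ht₁, rfl⟩ := hwin u₁ (abs_lt.mpr ⟨hu₁.1, hu₁.2⟩)
    obtain ⟨t₂, ht₂, rfl⟩ := hwin u₂ (abs_lt.mpr ⟨hu₂.1, hu₂.2⟩)
    have ht12 : t₁ < t₂ := (hμ.lt_iff_lt ht₁ ht₂).mp h12
    have h := hmn (hJ t₁ ht₁).2 (hJ t₂ ht₂).2 ht12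
    simp only at h ⊢
    rwa [hrepr t₁ ht₁, hrepr t₂ ht₂] at h
  have hdpos : 0 < (deriv w (D.pt i) * τ).re := by
    rcases hdr.lt_or_eq with h | h
    · exact h
    · exfalso
      have h0 : deriv w (D.pt i) * τ = 0 :=
        Complex.ext (by rw [← h, Complex.zero_re]) (by rw [hdi, Complex.zero_im])
      exact mul_ne_zero hderiv hτne h0
  refine ⟨τ, hτ, ⟨ε₁, hε₁0, fun t ht ↦ ⟨μ t, ?_, hrepr t ⟨by linarith [ht.1], ht.2.le⟩⟩⟩, ?_⟩
  · rw [← hμ0]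
    exact hμ ⟨by linarith, by linarith⟩ ⟨by linarith [ht.1], ht.2.le⟩ ht.1
  -- the side of the interior
  have hflτ : ∀ z ∈ frontier D.carrier, dist z (D.pt i) < min r₀ r₁ →
      ((z - D.pt i) / τ).im = 0 := by
    intro z hz hzr
    rcases hττ₀ with rfl | rfl
    · exact hfl z hz hzr
    · rw [div_neg, Complex.neg_im, hfl z hz hzr, neg_zero]
  obtain ⟨ν, hν, hH⟩ := transfer_halfBall_subset hΩ hτ hbf hr0 hflτ
  have hτI : τ * Complex.I ≠ 0 := mul_ne_zero hτne Complex.I_ne_zero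
  have hdistray : ∀ (s : ℝ) (v : ℂ), 0 < s → ‖v‖ = 1 → dist (D.pt i + (s : ℂ) * v) (D.pt i) = s := by
    intro s v hs hv
    rw [dist_eq_norm, add_sub_cancel_left, norm_mul, Complex.norm_real, hv, mul_one,
      Real.norm_eq_abs, abs_of_pos hs]
  have hnormτI : ‖τ * Complex.I‖ = 1 := by rw [norm_mul, hτ, Complex.norm_I, mul_one]
  rcases hν with rfl | rfl
  · refine ⟨min r₀ r₁, hr0, fun s hs ↦ hH _ ?_ ?_⟩
    · rw [hdistray s _ hs.1 hnormτI]
      exact hs.2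
    · rw [add_sub_cancel_left, mul_div_assoc, div_self hτI, mul_one, Complex.ofReal_re]
      exact hs.1
  · exfalso
    have hray : ∀ s : ℝ, 0 < s → s < min r₀ r₁ →
        D.pt i + (s : ℂ) * (-(τ * Complex.I)) ∈ D.carrier := by
      intro s hs hsr
      refine hH _ ?_ ?_
      · rw [hdistray s _ hs (by rw [norm_neg, hnormτI])]
        exact hsr
      · rw [add_sub_cancel_left, mul_div_assoc, div_self (neg_ne_zero.mpr hτI), mul_one,
          Complex.ofReal_re]
        exact hs
    have h := transfer_im_deriv_mul_nonneg hr0 hray hpos hwb hwd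
    have h2 : (deriv w (D.pt i) * -(τ * Complex.I)).im = -(deriv w (D.pt i) * τ).re := by
      rw [mul_neg, Complex.neg_im, ← mul_assoc, Complex.mul_I_im]
    rw [h2] at h
    linarith

/-- **GEOM — the flat-mark geometry of the crux's data.** For a marked Jordan domain with flat
marks and a holomorphic bijection `w : D → ℍ` (holomorphic near the marks) whose boundary values
have increasing real part near every mark: the orientation clause holds at every mark,
`w′(pt i) ≠ 0`, and `w` is injective on the marked points. This is the first hypothesis of
`s6_transferOfGeometry` (Part 2). [folklore] -/
theorem s6_flatMarkGeometry :
    (∀ (k : ℕ) (D : Literature.Probability.RandomPlanarGeometry.MarkedDomain k), (∀ i, (∃ r : ℝ, 0 < r ∧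
    ((∀ z ∈ frontier D.carrier, dist z (D.pt i) < r → z.im = (D.pt i).im) ∨ (∀ z ∈ frontier D.carrier,
    dist z (D.pt i) < r → z.re = (D.pt i).re)))) → ∀ (w : ℂ → ℂ) (U : Set ℂ), IsOpen U → D.carrier ⊆ U →
    (∀ i, D.pt i ∈ U) → DifferentiableOn ℂ w U → Set.BijOn w D.carrier {z : ℂ | 0 < z.im} →
    (∀ i, ∃ ε : ℝ, 0 < ε ∧ StrictMonoOn (fun t : ℝ ↦ (w (D.boundary t)).re)
    (Set.Ioo (D.mark i - ε) (D.mark i + ε))) →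
    (∀ i, ∃ τ : ℂ, ‖τ‖ = 1 ∧ (∃ ε : ℝ, 0 < ε ∧ ∀ t ∈ Set.Ioo (D.mark i) (D.mark i + ε), ∃ s : ℝ,
    0 < s ∧ D.boundary t = D.pt i + (s : ℂ) * τ) ∧ (∃ ε : ℝ, 0 < ε ∧ ∀ s ∈ Set.Ioo (0 : ℝ) ε,
    D.pt i + (s : ℂ) * (τ * Complex.I) ∈ D.carrier)) ∧ (∀ i, deriv w (D.pt i) ≠ 0) ∧
    (∀ i i', i ≠ i' → w (D.pt i) ≠ w (D.pt i'))) := by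
  intro k D hflat w U hU hsub hpt hw hbij hmono
  have hΩ : IsOpen D.carrier := D.isOpen
  have hpos : ∀ z ∈ D.carrier, 0 < (w z).im := fun z hz ↦ hbij.mapsTo hz
  have hreal : ∀ z ∈ frontier D.carrier, z ∈ U → (w z).im = 0 :=
    fun z hz hzU ↦ transfer_im_eq_zero_of_frontier hΩ hU hsub hw hbij hz hzU
  -- at every mark: a flat ball inside `U`
  have hloc : ∀ i, ∃ r : ℝ, 0 < r ∧ (∀ z, dist z (D.pt i) < r → z ∈ U) ∧ ∃ τ₀ : ℂ, ‖τ₀‖ = 1 ∧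
      ∀ z ∈ frontier D.carrier, dist z (D.pt i) < r → ((z - D.pt i) / τ₀).im = 0 := by
    intro i
    obtain ⟨r₀, hr₀, hfl₀⟩ := hflat i
    obtain ⟨r₁, hr₁, hr₁U⟩ := Metric.isOpen_iff.mp hU (D.pt i) (hpt i)
    obtain ⟨τ₀, hτ₀, h⟩ := transfer_flat_dir hfl₀
    exact ⟨min r₀ r₁, lt_min hr₀ hr₁, fun z hz ↦ hr₁U (lt_of_lt_of_le hz (min_le_right _ _)), τ₀,
      hτ₀, fun z hz hzr ↦ h z hz (lt_of_lt_of_le hzr (min_le_left _ _))⟩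
  have hderiv : ∀ i, deriv w (D.pt i) ≠ 0 := by
    intro i
    obtain ⟨r, hr, hrU, τ₀, hτ₀, hfl⟩ := hloc i
    obtain ⟨ν, hν, hH⟩ := transfer_halfBall_subset hΩ hτ₀ (D.pt_mem_frontier i) hr hfl
    have hν1 : ‖ν‖ = 1 := by
      rcases hν with rfl | rfl
      · rw [norm_mul, hτ₀, Complex.norm_I, mul_one]
      · rw [norm_neg, norm_mul, hτ₀, Complex.norm_I, mul_one]
    exact transfer_deriv_ne_zero hν1 hr hH hpos (hreal _ (D.pt_mem_frontier i) (hpt i))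
      (hw.analyticAt (hU.mem_nhds (hpt i))) hbij.injOn
  refine ⟨fun i ↦ transfer_orientation D i hU hsub (hpt i) hw hbij (hflat i) (hmono i) (hderiv i),
    hderiv, fun i i' hii' ↦ ?_⟩
  obtain ⟨r₁, hr₁, hr₁U, -⟩ := hloc i
  obtain ⟨r₂, hr₂, hr₂U, -⟩ := hloc i'
  exact transfer_boundary_injective hΩ hbij.injOn hpos (fun h ↦ hii' (D.pt_injective h))
    (frontier_subset_closure (D.pt_mem_frontier i))
    (frontier_subset_closure (D.pt_mem_frontier i')) (hreal _ (D.pt_mem_frontier i) (hpt i))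
    (hw.analyticAt (hU.mem_nhds (hpt i))).hasStrictDerivAt (hderiv i)
    (hw.analyticAt (hU.mem_nhds (hpt i'))).hasStrictDerivAt (hderiv i') hr₁ hr₂
    (fun z hz hzd ↦ hreal z hz (hr₁U z hzd)) (fun z hz hzd ↦ hreal z hz (hr₂U z hzd))

end Summit.CriticalPhenomena.CardyFormulaZ2.Cruxes.BoundaryDefectGaussianR.RainbowMonomialsInExcursionKernels

end
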